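import Summits.CriticalPhenomena.PercolationContinuityZ3.Theorems.PercNearOneGluingNoHeavyPcintChordMemKernel
import HarnessLib

/-!
# PCINT lane, reduced-state B3r certificates (bond): tables, the row check, and the kernel certificate theorem

Cell `prim-pcint` (PAPER-2 track (iii)), seat `prim-pcint-2` (gen 4); support file (`--supports stmt-CriticalPhenomena-4575`).
Does NOT build on p205010.  A certificate is a search tree `NawK.NT` (prim-pcint-1 gen 5, reused with the same payload:
weight `V`, state, per-letter successor datum `(row, symmetry number)`); `BondK.checkRowB τ d N pn R S D lamN lamD syms t i`
recomputes the SAW step of row `i` at every letter (`BondK.mstepK`), matches it against the listed datum up to the listed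
symmetry (`BondK.termOKB`), and checks the integer Collatz–Wielandt inequality
`lamD · Σ_a pn·((D-pn)R)^c·D^{4d-2c}·S^g·D^{2d-g}·(D+S ‖ 2D)·V_j ≤ lamN · 2 · D^{6d+2} · V_i` (`BondK.termValB`, `BondK.rowValB`;
`c = bchordK ≤ 2d`, `g = bgapK ≤ 2d`).  **`BondK.le_criticalProb_of_checkRowsB`**: if all rows `i < N` pass, row `0` is the
empty state, the symmetry numbers denote lattice symmetries, `pn ≤ D`, `0 < S ≤ D`, `D² ≤ S² + pn²` (`s̄² ≥ 1-p²`),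
`D² ≤ S·R` (`s̄·r ≥ 1`), `(D-pn)·R ≤ D²` (`(1-p)·r ≤ 1`), `lamN < lamD`, then `pn/D ≤ p_c^bond(ℤ^d)`
(via `le_criticalProb_zd_of_chordMemTable`).  Memo: run/shared/lean/prim/pcint/REDUCTIONS.md §B3r, CERTIFICATE-FORMAT.md.
-/

namespace Summit.CriticalPhenomena.PercolationContinuityZ3.Theorems.Pcint

open Finset Literature.Probability.Percolation Literature.Probability.LatticeModels

namespace BondK

open NawK (KState toM WF letters letterIdx NT seteqK actK toM_eq_of_seteqK toM_actK spermKL mem_letters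
  nodup_letters sum_letters_eq length_of_WF)

variable {d : ℕ}

/-! ### Row checks -/

section Check

variable (τ d N pn R S D lamN lamD : ℕ) (syms : List (List (ℕ × Bool))) (t : NT)

/-- The MATCH test of one letter of a row: a recomputed rejection must be listed as a rejection; a recomputed successor
must be, as a set, the listed row's state moved by the listed symmetry. [folklore] -/
def termOKB (L : KState) (a : Fin d × Bool) (os : Option (ℕ × ℕ)) : Bool :=
  match mstepK τ d L a, os with
  | none, none => true
  | some T, some (j, c) => decide (j < N) && decide (c < syms.length) && seteqK T (actK (syms.getD c []) (NawK.stOf t j))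
  | _, _ => false

/-- The integer value of one letter of a row: `pn · ((D-pn) R)^c · D^{4d-2c} · S^g · D^{2d-g} · (D+S ‖ 2D) · V_j` for a listed
successor `j` (`c`, `g`, corner flag recomputed from the row's state), `0` for a listed rejection. [folklore] -/
def termValB (L : KState) (a : Fin d × Bool) (os : Option (ℕ × ℕ)) : ℕ :=
  match os with
  | none => 0
  | some jc => pn * ((D - pn) * R) ^ bchordK d L a * D ^ (4 * d - 2 * bchordK d L a) * S ^ bgapK d L a *
      D ^ (2 * d - bgapK d L a) * (if bcornerK d L a then D + S else 2 * D) * NawK.vOf t jc.1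

/-- The integer row sum. [folklore] -/
def rowValB (L : KState) (sc : ℕ → Option (ℕ × ℕ)) : ℕ :=
  ((letters d).map fun a => termValB d pn R S D t L a (sc (letterIdx a))).sum

/-- **The row check**: the row exists, its state is well formed, its weight is positive, every letter matches the
recomputed step, and the integer Collatz–Wielandt inequality `lamD · Σ ≤ lamN · 2 · D^{6d+2} · V` holds. [folklore] -/
def checkRowB (i : ℕ) : Bool :=
  match t.find i with
  | none => false
  | some v =>
    WF d v.2.1 && decide (1 ≤ v.1) &&
      (letters d).all (fun a => termOKB τ d N syms t v.2.1 a (v.2.2.getD (letterIdx a) none)) &&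
      decide (lamD * rowValB d pn R S D t v.2.1 (fun k => v.2.2.getD k none) ≤ lamN * 2 * D ^ (6 * d + 2) * v.1)

end Check

/-! ### Soundness: checked rows bound `p_c^bond(ℤ^d)` from below -/

section Sound

variable {τ d N pn R S D lamN lamD : ℕ} {syms : List (List (ℕ × Bool))} {t : NT}

/-- What a passed row check says. [folklore] -/
theorem checkRowB_spec {i : ℕ} (h : checkRowB τ d N pn R S D lamN lamD syms t i = true) :
    ∃ v, t.find i = some v ∧ WF d v.2.1 = true ∧ 1 ≤ v.1 ∧
      (∀ a, termOKB τ d N syms t v.2.1 a (v.2.2.getD (letterIdx a) none) = true) ∧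
      lamD * rowValB d pn R S D t v.2.1 (fun k => v.2.2.getD k none) ≤ lamN * 2 * D ^ (6 * d + 2) * v.1 := by
  unfold checkRowB at h
  cases hf : t.find i with
  | none => rw [hf] at h; exact Bool.noConfusion h
  | some v =>
    rw [hf] at h
    simp only [Bool.and_eq_true, decide_eq_true_eq, List.all_eq_true] at h
    obtain ⟨⟨⟨hwf, hv⟩, hall⟩, hineq⟩ := h
    exact ⟨v, rfl, hwf, hv, fun a => hall a (mem_letters a), hineq⟩

/-- The real value of an integer letter term. [folklore] -/
theorem termValB_real_eq {c g F Vj : ℕ} (hc : c ≤ 2 * d) (hg : g ≤ 2 * d) (hD : (0 : ℝ) < D) :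
    ((pn * ((D - pn) * R) ^ c * D ^ (4 * d - 2 * c) * S ^ g * D ^ (2 * d - g) * F * Vj : ℕ) : ℝ) /
        (2 * (D : ℝ) ^ (6 * d + 2)) =
      (pn : ℝ) / D * ((((D - pn : ℕ) : ℝ) * R) / (D : ℝ) ^ 2) ^ c * ((S : ℝ) / D) ^ g * ((F : ℝ) / (2 * D)) * Vj := by
  have hsplit : (D : ℝ) ^ (6 * d + 2) =
      (D : ℝ) ^ (4 * d - 2 * c) * ((D : ℝ) ^ 2) ^ c * ((D : ℝ) ^ (2 * d - g) * (D : ℝ) ^ g) * (D : ℝ) ^ 2 := by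
    rw [← pow_mul, ← pow_add, ← pow_add, ← pow_add, ← pow_add]; congr 1; omega
  rw [hsplit, div_pow, div_pow]
  push_cast
  field_simp

/-- **Soundness of the kernel certificate (bond).**  If every row `i < N` of the table passes `checkRowB`, row `0` carries
the empty state, the symmetry numbers denote lattice symmetries (`syms c = spermKL (sym c)`), and the constants satisfy
`pn ≤ D`, `0 < S ≤ D`, `D² ≤ S² + pn²` (`s̄² ≥ 1 - p²` for `s̄ = S/D`), `D² ≤ S·R` (`s̄·r ≥ 1` for `r = R/D`),
`(D - pn)·R ≤ D²` (`(1-p)·r ≤ 1`), `lamN < lamD`, then `pn / D ≤ p_c^bond(ℤ^d)`. [folklore] -/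
theorem le_criticalProb_of_checkRowsB [NeZero d] (hτ : 2 ≤ τ) (sym : ℕ → SPerm d)
    (hsyms : ∀ c < syms.length, syms.getD c [] = spermKL (sym c))
    (hrows : ∀ i < N, checkRowB τ d N pn R S D lamN lamD syms t i = true)
    (hN : 0 < N) (h0 : NawK.stOf t 0 = []) (hD : 0 < D) (hpn : pn ≤ D) (hS1 : S ≤ D) (hS0 : 0 < S)
    (hSS : D ^ 2 ≤ S ^ 2 + pn ^ 2) (hSR : D ^ 2 ≤ S * R) (hpr : (D - pn) * R ≤ D ^ 2) (hlam : lamN < lamD) :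
    (pn : ℝ) / D ≤ criticalProb (zdGraph d) 0 := by
  classical
  have hDr : (0 : ℝ) < D := Nat.cast_pos.2 hD
  have hlamDr : (0 : ℝ) < lamD := Nat.cast_pos.2 (by omega)
  -- the constants
  set p : unitInterval := ⟨(pn : ℝ) / D, div_nonneg (Nat.cast_nonneg _) hDr.le,
    div_le_one_of_le₀ (by exact_mod_cast hpn) hDr.le⟩ with hp
  set sb : ℝ := (S : ℝ) / D with hsb
  set κb : ℝ := ((D : ℝ) + S) / (2 * D) with hκb
  set r : ℝ := (R : ℝ) / D with hr
  set lam : ℝ := (lamN : ℝ) / lamD with hlamdef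
  have hpc : (p : ℝ) = (pn : ℝ) / D := rfl
  have hsb0 : 0 < sb := div_pos (Nat.cast_pos.2 hS0) hDr
  have hsb1 : sb ≤ 1 := div_le_one_of_le₀ (by exact_mod_cast hS1) hDr.le
  have hκ : (1 + sb) / 2 ≤ κb := by rw [hκb, hsb]; apply le_of_eq; field_simp
  have hSr : (S : ℝ) ≤ D := by exact_mod_cast hS1
  have hκb1 : κb ≤ 1 := by rw [hκb, div_le_one (by positivity)]; linarith
  have hκb0 : 0 ≤ κb := by rw [hκb]; positivity
  have hr0 : 0 ≤ r := div_nonneg (Nat.cast_nonneg _) hDr.le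
  have hlam0 : 0 ≤ lam := div_nonneg (Nat.cast_nonneg _) hlamDr.le
  have hlam1 : lam < 1 := (div_lt_one hlamDr).2 (by exact_mod_cast hlam)
  have hsub : (((D - pn : ℕ) : ℝ)) = (D : ℝ) - pn := Nat.cast_sub hpn
  have hps : 1 - (p : ℝ) ^ 2 ≤ sb ^ 2 := by
    have key : (D : ℝ) ^ 2 ≤ (S : ℝ) ^ 2 + (pn : ℝ) ^ 2 := by exact_mod_cast hSS
    rw [hpc, hsb, div_pow, div_pow, sub_le_iff_le_add, ← add_div, le_div_iff₀ (by positivity), one_mul]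
    exact key
  have hsr : 1 ≤ sb * r := by
    have key : (D : ℝ) ^ 2 ≤ (S : ℝ) * R := by exact_mod_cast hSR
    rw [hsb, hr, div_mul_div_comm, le_div_iff₀ (by positivity), one_mul, ← sq]
    exact key
  have hprr : (1 - (p : ℝ)) * r ≤ 1 := by
    have key : ((D : ℝ) - pn) * R ≤ (D : ℝ) ^ 2 := by rw [← hsub]; exact_mod_cast hpr
    rw [hpc, hr, show (1 - (pn : ℝ) / D) * ((R : ℝ) / D) = ((D : ℝ) - pn) * R / (D : ℝ) ^ 2 by field_simp,
      div_le_one (by positivity)]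
    exact key
  -- the chord factor `cr = (1-p) r = ((D-pn) R)/D²`
  have hcr : (1 - (p : ℝ)) * r = (((D - pn : ℕ) : ℝ) * R) / (D : ℝ) ^ 2 := by
    rw [hsub, hpc, hr]; field_simp
  have hcr0 : 0 ≤ (1 - (p : ℝ)) * r := mul_nonneg (sub_nonneg.2 p.2.2) hr0
  -- the semantic table
  let Rw : Fin N → MState d := fun i => toM (NawK.stOf t i)
  let V : Fin N → ℝ := fun i => (NawK.vOf t i : ℝ)
  let sc : Fin N → Fin d × Bool → Option (Fin N × SPerm d) := fun i a =>
    match NawK.scOf t i (letterIdx a) with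
    | none => none
    | some jc => if h : jc.1 < N then some ((⟨jc.1, h⟩ : Fin N), sym jc.2) else none
  -- row data
  have hrow : ∀ i : Fin N, ∃ v, t.find i = some v ∧ WF d v.2.1 = true ∧ 1 ≤ v.1 ∧
      (∀ a, termOKB τ d N syms t v.2.1 a (v.2.2.getD (letterIdx a) none) = true) ∧
      lamD * rowValB d pn R S D t v.2.1 (fun k => v.2.2.getD k none) ≤ lamN * 2 * D ^ (6 * d + 2) * v.1 :=
    fun i => checkRowB_spec (hrows i i.2)
  have hst : ∀ (i : Fin N) v, t.find i = some v → NawK.stOf t i = v.2.1 := fun i v h => by simp [NawK.stOf, h]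
  have hv : ∀ (i : Fin N) v, t.find i = some v → NawK.vOf t i = v.1 := fun i v h => by simp [NawK.vOf, h]
  have hsc : ∀ (i : Fin N) v, t.find i = some v → ∀ k, NawK.scOf t i k = v.2.2.getD k none := fun i v h k => by
    simp [NawK.scOf, h]
  have hV : ∀ i, 1 ≤ V i := fun i => by
    obtain ⟨v, hf, -, hv1, -⟩ := hrow i
    show (1 : ℝ) ≤ (NawK.vOf t i : ℝ)
    rw [hv i v hf]; exact_mod_cast hv1
  have h0' : Rw ⟨0, hN⟩ = ∅ := by
    show toM (NawK.stOf t 0) = (∅ : MState d)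
    rw [h0]; rfl
  -- simulation
  have hsim : ∀ i a, simRel Rw (mstep τ (Rw i) a) (sc i a) = true := by
    intro i a
    obtain ⟨v, hf, hwf, -, hok, -⟩ := hrow i
    have hRi : Rw i = toM v.2.1 := by show toM (NawK.stOf t i) = _; rw [hst i v hf]
    have hoka := hok a
    unfold termOKB at hoka
    have hsci : sc i a = (match v.2.2.getD (letterIdx a) none with
        | none => none
        | some jc => if h : jc.1 < N then some ((⟨jc.1, h⟩ : Fin N), sym jc.2) else none) := by
      show (match NawK.scOf t i (letterIdx a) with
        | none => none
        | some jc => if h : jc.1 < N then some ((⟨jc.1, h⟩ : Fin N), sym jc.2) else none) = _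
      rw [hsc i v hf]
    rw [hRi, mstep_toM hwf, hsci]
    cases hT : mstepK τ d v.2.1 a with
    | none =>
      rw [hT] at hoka
      cases hos : v.2.2.getD (letterIdx a) none with
      | none => rfl
      | some jc => rw [hos] at hoka; exact Bool.noConfusion hoka
    | some T =>
      rw [hT] at hoka
      cases hos : v.2.2.getD (letterIdx a) none with
      | none => rw [hos] at hoka; exact Bool.noConfusion hoka
      | some jc =>
        rw [hos] at hoka
        rcases jc with ⟨j, c⟩
        simp only [Bool.and_eq_true, decide_eq_true_eq] at hoka
        obtain ⟨⟨hjN, hc⟩, hseq⟩ := hoka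
        simp only [Option.map_some, dif_pos hjN, simRel, decide_eq_true_eq]
        rw [toM_eq_of_seteqK hseq, hsyms c hc, toM_actK]
  -- Collatz–Wielandt rows
  have hcw : ∀ i, (∑ a : Fin d × Bool, match sc i a with
      | none => 0
      | some jg => (p : ℝ) * bwt ((1 - p) * r) sb κb (Rw i) a * V jg.1) ≤ lam * V i := by
    intro i
    obtain ⟨v, hf, hwf, hv1, hok, hineq⟩ := hrow i
    have hRi : Rw i = toM v.2.1 := by show toM (NawK.stOf t i) = _; rw [hst i v hf]
    -- each summand is at most the integer term over `2·D^{6d+2}`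
    have hterm : ∀ a, (match sc i a with
        | none => 0
        | some jg => (p : ℝ) * bwt ((1 - p) * r) sb κb (Rw i) a * V jg.1) ≤
        (termValB d pn R S D t v.2.1 a (v.2.2.getD (letterIdx a) none) : ℝ) / (2 * (D : ℝ) ^ (6 * d + 2)) := by
      intro a
      have hoka := hok a
      unfold termOKB at hoka
      have hsci : sc i a = (match v.2.2.getD (letterIdx a) none with
          | none => none
          | some jc => if h : jc.1 < N then some ((⟨jc.1, h⟩ : Fin N), sym jc.2) else none) := by
        show (match NawK.scOf t i (letterIdx a) with
          | none => none
          | some jc => if h : jc.1 < N then some ((⟨jc.1, h⟩ : Fin N), sym jc.2) else none) = _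
        rw [hsc i v hf]
      rw [hsci]
      cases hos : v.2.2.getD (letterIdx a) none with
      | none => simp only [termValB, Nat.cast_zero, zero_div, le_refl]
      | some jc =>
        rw [hos] at hoka
        cases hT : mstepK τ d v.2.1 a with
        | none => rw [hT] at hoka; exact Bool.noConfusion hoka
        | some T =>
          rw [hT] at hoka
          rcases jc with ⟨j, c⟩
          simp only [Bool.and_eq_true, decide_eq_true_eq] at hoka
          obtain ⟨⟨hjN, -⟩, -⟩ := hoka
          simp only [dif_pos hjN, termValB]
          rw [termValB_real_eq (bchordK_le _ _) (bgapK_le _ _) hDr]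
          -- compare factor by factor
          have hVj : V ⟨j, hjN⟩ = (NawK.vOf t j : ℝ) := rfl
          rw [hVj, hRi]
          have hc := bchordK_le_bchord hwf a (d := d)
          have hg := bgapK_le_bgap hwf a (d := d)
          have hcr1 : (1 - (p : ℝ)) * r ≤ 1 := hprr
          have hpowc : ((1 - (p : ℝ)) * r) ^ bchord (toM v.2.1 : MState d) a ≤
              ((((D - pn : ℕ) : ℝ) * R) / (D : ℝ) ^ 2) ^ bchordK d v.2.1 a := by
            rw [← hcr]; exact pow_le_pow_of_le_one hcr0 hcr1 hc
          have hpowg : sb ^ bgap (toM v.2.1 : MState d) a ≤ ((S : ℝ) / D) ^ bgapK d v.2.1 a :=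
            pow_le_pow_of_le_one hsb0.le hsb1 hg
          have hcf : (if bcorner (toM v.2.1 : MState d) a then κb else 1) ≤
              (((if bcornerK d v.2.1 a then D + S else 2 * D : ℕ) : ℝ) / (2 * D)) := by
            by_cases hcK : bcornerK d v.2.1 a = true
            · rw [if_pos (bcorner_of_bcornerK hwf a hcK), if_pos hcK, hκb]; push_cast; exact le_rfl
            · rw [if_neg hcK]
              have e2 : (((2 * D : ℕ) : ℝ)) / (2 * D) = 1 := by push_cast; field_simp
              rw [e2]
              split_ifs
              · exact hκb1
              · exact le_rfl
          have hp0 : (0 : ℝ) ≤ (pn : ℝ) / D := div_nonneg (Nat.cast_nonneg _) hDr.le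
          have hF0 : (0 : ℝ) ≤ (((if bcornerK d v.2.1 a then D + S else 2 * D : ℕ) : ℝ) / (2 * D)) := by positivity
          show (pn : ℝ) / D * (((1 - (p : ℝ)) * r) ^ bchord (toM v.2.1 : MState d) a *
              (sb ^ bgap (toM v.2.1 : MState d) a * (if bcorner (toM v.2.1 : MState d) a then κb else 1))) *
              (NawK.vOf t j : ℝ) ≤ _
          calc (pn : ℝ) / D * (((1 - (p : ℝ)) * r) ^ bchord (toM v.2.1 : MState d) a *
                (sb ^ bgap (toM v.2.1 : MState d) a * (if bcorner (toM v.2.1 : MState d) a then κb else 1))) *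
                (NawK.vOf t j : ℝ)
              ≤ (pn : ℝ) / D * (((((D - pn : ℕ) : ℝ) * R) / (D : ℝ) ^ 2) ^ bchordK d v.2.1 a *
                (((S : ℝ) / D) ^ bgapK d v.2.1 a *
                  ((((if bcornerK d v.2.1 a then D + S else 2 * D : ℕ) : ℝ) / (2 * D))))) * (NawK.vOf t j : ℝ) := by
                refine mul_le_mul_of_nonneg_right (mul_le_mul_of_nonneg_left (mul_le_mul hpowc
                  (mul_le_mul hpowg hcf ?_ ?_) ?_ ?_) hp0) (Nat.cast_nonneg _)
                · split_ifs
                  · exact hκb0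
                  · exact zero_le_one
                · positivity
                · exact mul_nonneg (pow_nonneg hsb0.le _) (by split_ifs <;> [exact hκb0; exact zero_le_one])
                · positivity
            _ = _ := by ring
    calc (∑ a : Fin d × Bool, match sc i a with
            | none => 0
            | some jg => (p : ℝ) * bwt ((1 - p) * r) sb κb (Rw i) a * V jg.1)
        ≤ ∑ a : Fin d × Bool, (termValB d pn R S D t v.2.1 a (v.2.2.getD (letterIdx a) none) : ℝ) /
            (2 * (D : ℝ) ^ (6 * d + 2)) := Finset.sum_le_sum fun a _ => hterm a
      _ = (rowValB d pn R S D t v.2.1 (fun k => v.2.2.getD k none) : ℝ) / (2 * (D : ℝ) ^ (6 * d + 2)) := by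
          rw [← Finset.sum_div, rowValB, ← sum_letters_eq, Nat.cast_list_sum, List.map_map]; rfl
      _ ≤ lam * V i := by
          rw [div_le_iff₀ (by positivity), hlamdef]
          show _ ≤ (lamN : ℝ) / lamD * (NawK.vOf t i : ℝ) * (2 * (D : ℝ) ^ (6 * d + 2))
          rw [hv i v hf, div_mul_eq_mul_div, div_mul_eq_mul_div, le_div_iff₀ hlamDr]
          calc (rowValB d pn R S D t v.2.1 (fun k => v.2.2.getD k none) : ℝ) * lamD
              = ((lamD * rowValB d pn R S D t v.2.1 (fun k => v.2.2.getD k none) : ℕ) : ℝ) := by push_cast; ring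
            _ ≤ ((lamN * 2 * D ^ (6 * d + 2) * v.1 : ℕ) : ℝ) := by exact_mod_cast hineq
            _ = (lamN : ℝ) * (v.1 : ℝ) * (2 * (D : ℝ) ^ (6 * d + 2)) := by push_cast; ring
  have main := le_criticalProb_zd_of_chordMemTable (d := d) hτ p hsb0 hsb1 hκ hps hr0 hsr hprr hlam0 hlam1
    Rw sc V ⟨0, hN⟩ h0' hV hsim hcw
  exact main

end Sound

end BondK

end Summit.CriticalPhenomena.PercolationContinuityZ3.Theorems.Pcint
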